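import Literature.NumberTheory.EllipticCurves.BinaryQuarticForms
import Mathlib.NumberTheory.Padics.PadicIntegers
import HarnessLib

/-!
# Bhargava–Shankar, Theorem 1.1 (the average size of the `2`-Selmer group is `3`): the printed
# decomposition of its proof into counting statements, vendored as named facts

Topic `Literature/NumberTheory/EllipticCurves`. Second layer of the decomposition of the named fact
`Literature.NumberTheory.EllipticCurves.averageRankLE_three_halves` (`BSDWave0.lean`; reduced to Theorem 1.1 =
`Literature.NumberTheory.EllipticCurves.average_card_selmerTwo` / `heightAverageLE_card_selmerTwo` of `BSDSelmer.lean` by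
`BSDWave0Proofs.lean`), continuing `BinaryQuarticForms.lean` (vocabulary of integral binary
quartic forms; Thm 1.6 = 2.1, Thm 1.7, and the `2`-Selmer parametrization Thm 5.6 as named facts).

Source: M. Bhargava, A. Shankar, *Binary quartic forms having bounded invariants, and the
boundedness of the average rank of elliptic curves*, Ann. of Math. (2) 181 (2015) 191–242,
doi:10.4007/annals.2015.181.1.3. **Numbering caveat** (as in `BinaryQuarticForms.lean`): section,
equation and theorem numbers are those of the held arXiv text `arXiv:1006.1002v2`, whose §5 is
"The mean size of the `2`-Selmer group of elliptic curves" (§3 of the published version).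

## The printed proof of Theorem 1.1 (§5.4 of the arXiv text) and what is vendored here

Write `F` for the family of all elliptic curves `E_{A,B} : y² = x³ + Ax + B` (`p⁴ ∤ A` or
`p⁶ ∤ B`; the tree's `Literature.NumberTheory.EllipticCurves.IsInHeightFamily`), `I(E) = −3A`, `J(E) = −27B` (§5, p. 31), and
`N_X = #{E ∈ F : H(E) < X}` (`(Literature.heightFamilyBelow X).card`). B–S work in §5 with
`H'(E) = max(|I|³, J²/4) = (27/4)·H(E)`, which orders curves identically; below every statement
is transcribed in the tree's normalisation `H(E_{A,B}) = max(4|A|³, 27B²) < X` (substitute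
`X ↦ 27X/4`), i.e. in `(A, B)`-coordinates.

1. **Lemma 5.15** (for `F` = all curves): `N_X = c_F · X^{5/6} + o(X^{5/6})` with
   `c_F = [Vol(R₁⁺) + Vol(R₁⁻)] · ∏_p M_p(U₁, F)`; in `(A,B)`-coordinates the archimedean factor is
   the area `4 / (4^{1/3} · 27^{1/2})` of `{(a,b) ∈ ℝ² : 4|a|³ < 1, 27b² < 1}` and
   `M_p(U₁,F) = 1 − p⁻¹⁰`, the density of `{(A,B) ∈ ℤ_p² : ¬(p⁴ ∣ A ∧ p⁶ ∣ B)}`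
   (`heightFamilyConstant`, fact `card_heightFamilyBelow_asymptotic`; B–S: "the proof is
   identical to that of Theorem (mcc)", i.e. the sieve of their §3.7 applied to Prop. 2.10; an
   elementary sieve, *proved* in the companion file: `card_heightFamilyBelow_asymptotic_holds`).
2. **Theorem 5.6** (`Literature.NumberTheory.EllipticCurves.bhargavaShankar_card_selmerTwo_eq`, vendored in `BinaryQuarticForms`):
   `#S₂(E) =` number of `PGL₂(ℚ)`-classes of locally soluble integral quartics with invariants
   `(2⁴I(E), 2⁶J(E))`; and (p. 33, first paragraph of the text after Lemma 5.11) the non-identity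
   elements correspond to the classes of *irreducible* such forms when `E` has no rational
   `2`-torsion, i.e. (p. 32) when `x³ + Ax + B` has no rational root (`HasRationalTwoTorsion`;
   this step is *proved* in the companion `Proofs` file).
3. **Propositions 5.7–5.9**: curves with a rational `2`-torsion point, and non-rigid curves, are
   negligible: Prop. 5.7 (`O(X^{1/2+ε})` such curves; proved in the companion file) and
   **Prop. 5.8** (the Selmer groups of the curves with rational `2`-torsion have `O(X^{3/4+ε})`
   elements in total; fact `bhargavaShankar_sum_card_selmerTwo_twoTorsion_le`; B–S: it "follows
   from Lemma (redres) and Theorem 5.6", i.e. from the geometry-of-numbers estimates of §2 for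
   reducible forms, Lemmas 2.3–2.4).
4. **Eq. (31)** (proof of Thm 5.14, from Thm 2.1, Thm 2.11, Prop. 5.12 and the uniformity
   estimate Prop. 5.13): `N(S^F; 2¹²X) = ζ(2)·[Vol(R₁⁺)+Vol(R₁⁻)]·∏_p M_p(V,F)·X^{5/6} + o(X^{5/6})`,
   where `N(S^F; 2¹²X)` is "the number of `PGL₂(ℚ)`-equivalence classes of locally soluble
   irreducible integral binary quartic forms having invariants `2⁴I` and `2⁶J` such that
   `(I,J) ∈ F^{inv}` and `H(2⁴I, 2⁶J) < 2¹²X`" (p. 34; note `H(2⁴I(E), 2⁶J(E)) = 2¹² H'(E)`), and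
   where, by the formula of **Prop. 5.12** for `M_p(V,F)` and **Lemma 5.16** (Brumer–Kramer:
   `#E(ℚ_p)/2E(ℚ_p) = #E(ℚ_p)[2]` for `p ≠ 2`, twice that for `p = 2`; fact
   `brumerKramer_card_quotient_two`), `M_p(V,F) = (1 − p⁻²)·c_p·M_p(U₁,F)` with `c₂ = 2`, `c_p = 1`
   otherwise, so that `ζ(2) ∏_p M_p(V,F) = 2 ∏_p M_p(U₁,F)` (last display of §5.4). The resulting
   statement `Σ_{E ∈ F, H(E) < X} #{classes of loc. sol. irreducible quartics with invariants
   (2⁴I(E), 2⁶J(E))} = 2·c_F·X^{5/6} + o(X^{5/6})` is the fact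
   `bhargavaShankar_sum_irredClassCount_asymptotic` — the deep content of the paper (§2 and
   §5.2–5.3), to be decomposed further (Thm 2.11, Prop. 5.12, Prop. 5.13 need `p`-adic measures on
   `V_{ℤ_p}`, not yet in the tree).
5. "Taking the ratio of (31) and (30) now yields Theorem 5.14", `= 2` by Lemma 5.16, hence the
   average of `#S₂(E) − 1` is `2` and Theorem 1.1 follows. This assembly (items 1–4 ⇒
   `average_card_selmerTwo` ⇒ `averageRankLE_three_halves`) is carried out, sorry-free, in the
   companion `BhargavaShankarCountingProofs.lean`, where items 1, 3 (Prop. 5.7) and the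
   identity-class step of item 2 are proved, leaving Thm 5.6, eq. (31) and Prop. 5.8 as the cited
   inputs.

## Contents

* `Literature.HasRationalTwoTorsion AB`: `x³ + Ax + B` has a rational root (p. 32).
* `Literature.NumberTheory.EllipticCurves.heightFamilyConstant`: the constant `c_F` of item 1.
* Named facts `card_heightFamilyBelow_asymptotic` (Lemma 5.15 for all curves),
  `bhargavaShankar_sum_irredClassCount_asymptotic` (eq. (31) with Prop. 5.12 and Lemma 5.16),
  `bhargavaShankar_sum_card_selmerTwo_twoTorsion_le` (Prop. 5.8),
  `brumerKramer_card_quotient_two` (Lemma 5.16), and its input `exists_finiteIndex_addEquiv_padicInt`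
  (Silverman, AEC Prop. VII.6.3 over `ℚ_p`: `E(ℚ_p)` has a finite-index subgroup `≅ ℤ_p`), from
  which the companion file derives Lemma 5.16 (`brumerKramer_card_quotient_two_of_AEC`).

## Design choices

* Everything is indexed, like `Literature.NumberTheory.EllipticCurves.heightAverage`, by the tree's finite sets
  `Literature.heightFamilyBelow X` (`X : ℕ`), and asymptotics `a_X = c X^{5/6} + o(X^{5/6})` are written
  `Tendsto (fun X ↦ a_X / X^{5/6}) atTop (𝓝 c)`; `O(X^{θ+ε})` bounds as
  `∀ ε > 0, ∃ C, ∀ X, · ≤ C · X^{θ+ε}` (vacuous demands at `X = 0` are harmless: both sides vanish).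
* Sets of forms are written inline in the shape used by `Literature.NumberTheory.EllipticCurves.bhargavaShankar_card_selmerTwo_eq`
  (`{f | f.IsLocallySoluble ∧ … ∧ f.I = 2⁴·(−3A) ∧ f.J = 2⁶·(−27B)}`), classes counted by
  `BinaryQuartic.pgl2QClassCount`.
* `ζ`-values are avoided: the Euler factor `∏_p (1 − p⁻¹⁰)` is written as a `tprod` over
  `Nat.Primes` (it equals `ζ(10)⁻¹`).
-/

noncomputable section

open scoped Classical
open Filter Topology

namespace Literature.NumberTheory.EllipticCurves

open BinaryQuartic

/-! ### Vocabulary -/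

/-- `E_{A,B} : y² = x³ + Ax + B` has a nontrivial rational `2`-torsion point iff the cubic
`x³ + Ax + B` has a rational root (Bhargava–Shankar, held arXiv text p. 32: "An elliptic curve
`E : y² = x³+Ax+B` over `ℚ` has a non-trivial `2`-torsion point defined over `ℚ` if and only if
the corresponding cubic equation `x³+Ax+B` has a rational root"); we take the latter as the
definition (the equivalence with "`E_{A,B}(ℚ)` has a point `P ≠ O` with `2P = O`" is proved in the
companion file, `hasRationalTwoTorsion_iff`). [cite: BhargavaShankarAnnals2015, §5.1 p. 32 (before Prop. 5.7; arXiv:1006.1002v2 numbering)] -/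
def HasRationalTwoTorsion (AB : ℤ × ℤ) : Prop :=
  ∃ r : ℚ, r ^ 3 + AB.1 * r + AB.2 = 0

/-- The constant `c_F = [Vol(R₁⁺) + Vol(R₁⁻)] · ∏_p M_p(U₁,F)` of Bhargava–Shankar's Lemma 5.15
for the family `F` of all elliptic curves, in the tree's coordinates `(A, B)` and height
`H = max(4|A|³, 27B²)`: the area `4/(4^{1/3}·27^{1/2})` of `{(a,b) ∈ ℝ² : 4|a|³ < 1, 27b² < 1}`
times `∏_p (1 − p⁻¹⁰)`, `1 − p⁻¹⁰` being the `p`-adic density of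
`{(A,B) ∈ ℤ_p² : ¬(p⁴ ∣ A ∧ p⁶ ∣ B)}` (held arXiv text, Lemma 5.15 and eq. (28) defining
`M_p(U₁,F)`). [cite: BhargavaShankarAnnals2015, Lemma 5.15 (arXiv:1006.1002v2 numbering)] -/
def heightFamilyConstant : ℝ :=
  4 / ((4 : ℝ) ^ (1 / 3 : ℝ) * (27 : ℝ) ^ (1 / 2 : ℝ)) *
    ∏' p : Nat.Primes, (1 - 1 / ((p : ℕ) : ℝ) ^ 10)

/-! ### Named facts -/

/-- **Bhargava–Shankar, Lemma 5.15, for the family of all elliptic curves** (held arXiv text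
§5.4, eq. (30); there for any large family `F` and the height `H'`): the number `N_X` of curves
`E_{A,B}` (`p⁴ ∤ A` or `p⁶ ∤ B`, `4A³ + 27B² ≠ 0`) with `H(E_{A,B}) = max(4|A|³, 27B²) < X`
satisfies `N_X = c_F · X^{5/6} + o(X^{5/6})`, `c_F = heightFamilyConstant`
(`= [Vol(R₁⁺)+Vol(R₁⁻)]·∏_p M_p(U₁,F)` transcribed to `(A,B)`-coordinates and `H`; B–S: "the proof
is identical to that of Theorem (mcc)", the sieve of their §3.7 — an elementary squarefree-type
sieve; discharged in the companion file as `card_heightFamilyBelow_asymptotic_holds`).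
[cite: BhargavaShankarAnnals2015, Lemma 5.15 (arXiv:1006.1002v2 numbering)] -/
def card_heightFamilyBelow_asymptotic : Prop :=
  Tendsto (fun X : ℕ ↦ ((heightFamilyBelow X).card : ℝ) / (X : ℝ) ^ (5 / 6 : ℝ)) atTop
    (𝓝 heightFamilyConstant)

/-- **Bhargava–Shankar, eq. (31) of the proof of Theorem 5.14, with `∏_p M_p(V,F)` evaluated by
Prop. 5.12 and Lemma 5.16, for the family `F` of all elliptic curves** (held arXiv text §5.4,
p. 34). Printed: `N(S^F; 2¹²X) = ζ(2)·[Vol(R₁⁺)+Vol(R₁⁻)]·∏_p M_p(V,F)·X^{5/6} + o(X^{5/6})`, where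
`N(S^F; 2¹²X)` is the number of `PGL₂(ℚ)`-equivalence classes of locally soluble irreducible
integral binary quartic forms having invariants `2⁴I` and `2⁶J` with `(I,J) = (I(E),J(E))`,
`E ∈ F`, `H(2⁴I,2⁶J) = 2¹²H'(E) < 2¹²X`; and `M_p(V,F) = (1 − p⁻²)·∫_{F_p^{inv}} #(E/2E)/#E[2](ℚ_p)
= (1 − p⁻²)·c_p·M_p(U₁,F)` with `c₂ = 2`, `c_p = 1` (`p ≠ 2`) by Lemma 5.16, so
`ζ(2)·∏_p M_p(V,F) = 2·∏_p M_p(U₁,F)` (last display of §5.4). In the tree's normalisation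
(`H(E) < X`, constant `c_F = heightFamilyConstant` of Lemma 5.15): summing over the curves
`E_{A,B}` of height `< X` the number of `PGL₂(ℚ)`-classes of locally soluble irreducible integral
quartics with invariants `(2⁴·(−3A), 2⁶·(−27B))` gives `2·c_F·X^{5/6} + o(X^{5/6})`. This is the
deep content of the paper (Thm 2.1, Thm 2.11, Prop. 5.12, Prop. 5.13).
[cite: BhargavaShankarAnnals2015, §5.4 eq. (31) with Prop. 5.12 and Lemma 5.16 (arXiv:1006.1002v2 numbering)] -/
def bhargavaShankar_sum_irredClassCount_asymptotic : Prop :=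
  Tendsto (fun X : ℕ ↦
      (∑ AB ∈ heightFamilyBelow X,
          (pgl2QClassCount {f : BinaryQuartic ℤ | f.IsLocallySoluble ∧ f.IsIrreducible ∧
              f.I = 2 ^ 4 * (-3 * AB.1) ∧ f.J = 2 ^ 6 * (-27 * AB.2)} : ℝ)) /
        (X : ℝ) ^ (5 / 6 : ℝ))
    atTop (𝓝 (2 * heightFamilyConstant))

/-- **Bhargava–Shankar, Prop. 5.8** (held arXiv text §5.1, p. 32): "The total number of elements
in the union of the `2`-Selmer groups of all elliptic curves over `ℚ` having a nontrivial rational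
`2`-torsion point and height bounded by `X` is `O(X^{3/4+ε})`." Rendered over the curves `E_{A,B}`
of the height family with `H(E_{A,B}) < X` and `x³ + Ax + B` having a rational root
(`HasRationalTwoTorsion`, the printed criterion for rational `2`-torsion, p. 32), the Selmer group
being the tree's `WeierstrassCurve.selmerGroup _ 2`: for every `ε > 0` there is `C` with
`Σ #Sel^(2)(E_{A,B}/ℚ) ≤ C · X^{3/4+ε}` for all `X`.
[cite: BhargavaShankarAnnals2015, Prop. 5.8 (arXiv:1006.1002v2 numbering)] -/
def bhargavaShankar_sum_card_selmerTwo_twoTorsion_le : Prop :=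
  ∀ ε : ℝ, 0 < ε → ∃ C : ℝ, ∀ X : ℕ,
    (∑ AB ∈ (heightFamilyBelow X).filter HasRationalTwoTorsion,
        (Nat.card ((shortWeierstrass AB).selmerGroup 2) : ℝ)) ≤ C * (X : ℝ) ^ (3 / 4 + ε)

/-- **Brumer–Kramer** (A. Brumer, K. Kramer, *The rank of elliptic curves*, Duke Math. J. 44
(1977); quoted as Bhargava–Shankar, Lemma 5.16, held arXiv text §5.4): for an elliptic curve `E`
over `ℚ_p`, `#(E(ℚ_p)/2E(ℚ_p)) = #E[2](ℚ_p)` if `p ≠ 2` and `= 2·#E[2](ℚ_p)` if `p = 2`. Here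
`E(ℚ_p)` is Mathlib's group of affine points over `ℚ_p`, `2E(ℚ_p)` the range of multiplication by
`2`, and `E[2](ℚ_p)` the `2`-torsion subgroup (`Nat.card`; the statement entails the finiteness
of `E(ℚ_p)/2E(ℚ_p)`). Derived in the companion file from Silverman AEC Prop. VII.6.3
(`exists_finiteIndex_addEquiv_padicInt` below): `brumerKramer_card_quotient_two_of_AEC`.
[cite: BhargavaShankarAnnals2015, Lemma 5.16 (arXiv:1006.1002v2 numbering)] -/
def brumerKramer_card_quotient_two : Prop :=
  ∀ (p : ℕ) [Fact p.Prime] (W : WeierstrassCurve ℚ_[p]) [W.IsElliptic],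
    Nat.card (W.toAffine.Point ⧸ (zsmulAddGroupHom (α := W.toAffine.Point) 2).range) =
      (if p = 2 then 2 else 1) * Nat.card (AddSubgroup.torsionBy W.toAffine.Point 2)

/-- **Silverman, AEC Prop. VII.6.3**, for `K = ℚ_p` (held 2nd ed., p. 178): "Let `K` be a finite
extension of `ℚ_p` […]. Then `E(K)` contains a subgroup of finite index that is isomorphic to `R⁺`,
the additive group of `R`" (`R` the ring of integers of `K`; proof via `E(K)/E₀(K)` finite,
`E₀(K)/E₁(K) ≅ Ẽ_ns(k)`, `E₁(K) ≅ Ê(𝓜)` and `Ê(𝓜^r) ≅ R⁺` for large `r`, IV.6.4(b)). Here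
`E(ℚ_p)` is Mathlib's group of affine points of an elliptic curve over `ℚ_p` and the subgroup is an
`AddSubgroup` of finite index additively isomorphic to `ℤ_p`. Vendored as the input from which
Lemma 5.16 (Brumer–Kramer, `brumerKramer_card_quotient_two`) follows by a Herbrand-quotient
computation (companion file). [cite: SilvermanAEC2009, Prop. VII.6.3] -/
def exists_finiteIndex_addEquiv_padicInt : Prop :=
  ∀ (p : ℕ) [Fact p.Prime] (W : WeierstrassCurve ℚ_[p]) [W.IsElliptic],
    ∃ A : AddSubgroup W.toAffine.Point, A.FiniteIndex ∧ Nonempty (A ≃+ ℤ_[p])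

end Literature.NumberTheory.EllipticCurves

end
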